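import Mathlib
import HarnessLib
import Summits.HubbardSuperconductivity.HubbardSuperconductivity.Theorems.KLProgrammeKLRegimeEngineTowerLevNumericsChoice

/-!
# Route `KLProgramme` — crux K3 ENGINE (stmt-HubbardSuperconductivity-20437 `KLRegimeEngineV17F2`), stub (b) v2, THE LEVELS PACKAGE (ℓ), instantiation (I5)-LEV-G:
# THE NUMERICS OF THE LEVELLED TOWER LAW, GENERIC IN THE RE-MEASUREMENT / UV / BASE CONSTANTS — serves the half-keyed rows (p660983/p664323) AND the
# floor-keyed twins of located-risk #10 «(ℓ)-LEV-ODD» cure (ε) ((R275)(A); units `klLevUnitF`, p668906) without change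
# (cell gate-hubbard-kl, seat hubbard-kl-k3c3-p2 g14, «(I5)-LEV re-key»; generic twin of …TowerLevNumerics / …TowerLevNumericsUV0; E1's (I5) by the substitute precedent)

The kit `towerBorn_le_law_tracks_of_profile` is unit-free; what ties an (I5) instance to a unit system are the FLOORS the profile rows (`hprof`) impose on `(A′, Q′)`:
for p4's half-keyed `R`-rows `A′ ≥ κ_A·(a₂ + A/(1−r))`, `Q′ ≥ Z·κ_Q·max Q Q_uv` with `κ_A = W·27⁵(C₁/C₂)8^{d−1}`, `a₂ = ε_x/B²`, `κ_Q = C₂²2^{1−d}`, `r = (√2^d)⁻¹`, plus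
the block-0 / base floors `A′ ≥ a₁ (= W·27⁵ε_x/B²)`, `Q′ ≥ Z·Q_uv (= Z·CE/ε_x²)`, `Q′ ≥ q₀`; under (ε) the exponents of the floor-keyed rows change but not the SHAPE.
This file proves the (I5) rows ONCE for arbitrary constants — `a₁ > 0`, `a₂, Q_uv, q₀ ≥ 0` (UV/base amplitudes and bases, already B-discounted by the caller), `κ_A > 0`,
`κ_Q ≥ 0`, `r < 1`, kit constants `σ Φ ψ ≥ 0`, `τ > 0`, unit prefactors `W, Z > 0`, imports/cell `ι₁ ι₂ X ≥ 0` — with the choices (equational binders, `rfl` at the call)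

  `ρ = max 4 (2τψ)`, `Q′ = Z·Q_uv + q₀ + 1`, `Q = ρ·Q′`, `a = a₁ + κ_A·a₂`, `Y = ι₂/(2Q′) + W·Z³·X/(4Q′²) + a·Q′/2`,
  `A = 2·Y·(1 − r)/(κ_A·Q′)`, `A′ = a + 2Y/Q′`, `ι₃ = W·Z³·X + A′·Q′³`,

and the residual rows: BLOCKING `max 1 Z · κ_Q · max 4 (2τψ) ≤ 1`, AMPLITUDE `8·Φ·τ·Y ≤ 1` and `128·e·ψ³·τ⁴·Φ·κ_A·Y ≤ (1 − r)·ρ³`.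
§1 rows (positivity; floors `a₁ ≤ A′`, `κ_A(a₂ + A/(1−r)) ≤ A′`, `Z·Q_uv ≤ Q′`, `Z·κ_Q·max Q Q_uv ≤ Q′`, `q₀ ≤ Q′`, `WZ³X ≤ ι₃`, `A′Q′³ ≤ ι₃`; `hu₁ hu₂`; `(N1) (N2)`);
§2 all kit numerics from `λ ≤ λ₀` / the two doors (the g13 core); §3 the choice of `B` (`a₁ = â₁/B²`, `a₂ = â₂/B²`, `ι₂ = ῑ₂/B`, `X = X̄/B²` ⇒ `Y ≤ Ȳ/B`; `B ≥ B₀` ⇒ both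
amplitude rows).  …TowerLevNumerics is the instance `κ_A = W27⁵(1 + (C₁/C₂)8^{d−1})`, `a₁ = W27⁵ε_x/B²`, `a₂ = ε_x/B²`, `r = (√2^d)⁻¹`, `κ_Q = C₂²2^{1−d}`, `Q_uv = CE/ε_x²`, `q₀ = 0`
(up to the bookkeeping of `ĉ`).
Pure real arithmetic; nothing about the model is asserted; nothing asserts (ℓ), any stub, K3 or superconductivity.
References: Benfatto–Giuliani–Mastropietro 2006 §2.8 (2.83), (2.93)–(2.98) [cite: BenfattoGiulianiMastropietro2006]; Gawȩdzki–Kupiainen 1985 §3.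
-/

noncomputable section

namespace Summit.HubbardSuperconductivity.HubbardSuperconductivity.Theorems.EngineV8

set_option linter.dupNamespace false -- summit = problem name (single-conjunct summit), D-0017

open Real Literature.MathematicalPhysics.QuantumLattice
open Summit.HubbardSuperconductivity.HubbardSuperconductivity.Theorems.KLRegimeSplit
open Summit.HubbardSuperconductivity.HubbardSuperconductivity.Theorems.DispersionFlow

/-! ## §1 The rows -/

section Rows

variable {σ Φ ψ τ W Z κA κQ r Quv a₁ a₂ q₀ ι₂ X ρ Q' Q a Y A A' ι₃ : ℝ}

/-- `1 ≤ Q′` for `Q′ = Z·Q_uv + q₀ + 1`. -/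
theorem towerLevNumericsG_one_le_Q' (hZ : 0 < Z) (hQuv : 0 ≤ Quv) (hq₀ : 0 ≤ q₀) (hQ' : Q' = Z * Quv + q₀ + 1) : 1 ≤ Q' := by
  have : 0 ≤ Z * Quv := by positivity
  rw [hQ']; linarith

/-- **Positivity**: `0 < Y` (it contains `a₁·Q′/2 > 0`), hence `0 < A`, `0 ≤ A′`, `0 ≤ ι₃`, `0 < Q′`, `0 < Q`, `0 < A·Q³`; also `0 < a`. -/
theorem towerLevNumericsG_pos
    (hW : 0 < W) (hZ : 0 < Z) (hκA : 0 < κA) (hr1 : r < 1) (hQuv : 0 ≤ Quv) (ha₁ : 0 < a₁) (ha₂ : 0 ≤ a₂) (hq₀ : 0 ≤ q₀)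
    (hι₂ : 0 ≤ ι₂) (hX : 0 ≤ X)
    (hρ : ρ = max 4 (2 * τ * ψ)) (hQ' : Q' = Z * Quv + q₀ + 1) (hQ : Q = ρ * Q') (ha : a = a₁ + κA * a₂)
    (hY : Y = ι₂ / (2 * Q') + W * Z ^ 3 * X / (4 * Q' ^ 2) + a * Q' / 2) (hA : A = 2 * Y * (1 - r) / (κA * Q'))
    (hA' : A' = a + 2 * Y / Q') (hι₃ : ι₃ = W * Z ^ 3 * X + A' * Q' ^ 3) :
    0 < a ∧ 0 < Y ∧ 0 < Q' ∧ 0 < Q ∧ 0 < A ∧ 0 ≤ A' ∧ 0 ≤ ι₃ ∧ 0 < A * Q ^ 3 := by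
  have hr : 0 < 1 - r := sub_pos.2 hr1
  have hρ0 : 0 < ρ := by rw [hρ]; exact lt_of_lt_of_le (by norm_num) (le_max_left _ _)
  have hQ'0 : 0 < Q' := lt_of_lt_of_le one_pos (towerLevNumericsG_one_le_Q' hZ hQuv hq₀ hQ')
  have hQ0 : 0 < Q := by rw [hQ]; positivity
  have hκa : 0 ≤ κA * a₂ := by positivity
  have ha0 : 0 < a := by rw [ha]; linarith
  have hY0 : 0 < Y := by
    have h1 : 0 ≤ ι₂ / (2 * Q') := by positivity
    have h2 : 0 ≤ W * Z ^ 3 * X / (4 * Q' ^ 2) := by positivity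
    have h3 : 0 < a * Q' / 2 := by positivity
    rw [hY]; linarith
  have hA0 : 0 < A := by rw [hA]; positivity
  have hA'0 : 0 ≤ A' := by rw [hA']; positivity
  have hι₃0 : 0 ≤ ι₃ := by rw [hι₃]; positivity
  exact ⟨ha0, hY0, hQ'0, hQ0, hA0, hA'0, hι₃0, by positivity⟩

/-- **The `A′`-floors**: `a₁ ≤ A′` and `κ_A·(a₂ + A/(1−r)) ≤ A′` (the second misses equality only by `a₁`). -/
theorem towerLevNumericsG_floorsA
    (hW : 0 < W) (hZ : 0 < Z) (hκA : 0 < κA) (hr1 : r < 1) (hQuv : 0 ≤ Quv) (ha₁ : 0 < a₁) (ha₂ : 0 ≤ a₂) (hq₀ : 0 ≤ q₀)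
    (hι₂ : 0 ≤ ι₂) (hX : 0 ≤ X)
    (hρ : ρ = max 4 (2 * τ * ψ)) (hQ' : Q' = Z * Quv + q₀ + 1) (hQ : Q = ρ * Q') (ha : a = a₁ + κA * a₂)
    (hY : Y = ι₂ / (2 * Q') + W * Z ^ 3 * X / (4 * Q' ^ 2) + a * Q' / 2) (hA : A = 2 * Y * (1 - r) / (κA * Q'))
    (hA' : A' = a + 2 * Y / Q') (hι₃ : ι₃ = W * Z ^ 3 * X + A' * Q' ^ 3) :
    a₁ ≤ A' ∧ κA * (a₂ + A / (1 - r)) ≤ A' := by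
  obtain ⟨_, hY0, hQ'0, _, hA0, _, _, _⟩ := towerLevNumericsG_pos hW hZ hκA hr1 hQuv ha₁ ha₂ hq₀ hι₂ hX hρ hQ' hQ ha hY hA hA' hι₃
  have hr : 0 < 1 - r := sub_pos.2 hr1
  have h2Y : 0 ≤ 2 * Y / Q' := by positivity
  have hκa : 0 ≤ κA * a₂ := by positivity
  constructor
  · rw [hA', ha]; linarith
  · have hlaw : κA * (A / (1 - r)) = 2 * Y / Q' := by
      have hr' : (1 - r) ≠ 0 := hr.ne'
      have h1 : 2 * Y * (1 - r) / (κA * Q') / (1 - r) = 2 * Y / (κA * Q') := by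
        rw [div_eq_iff hr']; ring
      rw [hA, h1]
      field_simp
    calc κA * (a₂ + A / (1 - r)) = κA * a₂ + κA * (A / (1 - r)) := by ring
      _ = κA * a₂ + 2 * Y / Q' := by rw [hlaw]
      _ ≤ A' := by rw [hA', ha]; linarith

/-- **The `Q′`-floors and the blocking consequences**: `Z·Q_uv ≤ Q′`, `q₀ ≤ Q′`, `Z·κ_Q·max Q Q_uv ≤ Q′` (from `max 1 Z·κ_Q·ρ ≤ 1`), `4Q′ ≤ Q`, `2τψQ′ ≤ Q`. -/
theorem towerLevNumericsG_floorsQ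
    (hZ : 0 < Z) (hκQ : 0 ≤ κQ) (hQuv : 0 ≤ Quv) (hq₀ : 0 ≤ q₀)
    (hρ : ρ = max 4 (2 * τ * ψ)) (hQ' : Q' = Z * Quv + q₀ + 1) (hQ : Q = ρ * Q')
    (hblock : max 1 Z * κQ * max 4 (2 * τ * ψ) ≤ 1) :
    Z * Quv ≤ Q' ∧ q₀ ≤ Q' ∧ Z * κQ * max Q Quv ≤ Q' ∧ 4 * Q' ≤ Q ∧ 2 * τ * ψ * Q' ≤ Q := by
  have hρ4 : 4 ≤ ρ := by rw [hρ]; exact le_max_left _ _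
  have hρτψ : 2 * τ * ψ ≤ ρ := by rw [hρ]; exact le_max_right _ _
  have hρ0 : 0 < ρ := lt_of_lt_of_le (by norm_num) hρ4
  have hQ'0 : 0 < Q' := lt_of_lt_of_le one_pos (towerLevNumericsG_one_le_Q' hZ hQuv hq₀ hQ')
  have hZQ : 0 ≤ Z * Quv := by positivity
  have hF3 : Z * Quv ≤ Q' := by rw [hQ']; linarith
  have hFq : q₀ ≤ Q' := by rw [hQ']; linarith
  have hb1 : Z * κQ * ρ ≤ 1 := by
    calc Z * κQ * ρ ≤ max 1 Z * κQ * ρ := mul_le_mul_of_nonneg_right (mul_le_mul_of_nonneg_right (le_max_right _ _) hκQ) hρ0.le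
      _ = max 1 Z * κQ * max 4 (2 * τ * ψ) := by rw [hρ]
      _ ≤ 1 := hblock
  have hb2 : κQ ≤ 1 := by
    have h14 : 1 * κQ * 4 ≤ max 1 Z * κQ * max 4 (2 * τ * ψ) :=
      mul_le_mul (mul_le_mul_of_nonneg_right (le_max_left _ _) hκQ) (le_max_left _ _) (by norm_num) (by positivity)
    nlinarith
  refine ⟨hF3, hFq, ?_, ?_, ?_⟩
  · rw [mul_max_of_nonneg _ _ (show (0 : ℝ) ≤ Z * κQ by positivity)]
    refine max_le ?_ ?_
    · rw [hQ]
      calc Z * κQ * (ρ * Q') = (Z * κQ * ρ) * Q' := by ring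
        _ ≤ 1 * Q' := mul_le_mul_of_nonneg_right hb1 hQ'0.le
        _ = Q' := one_mul _
    · calc Z * κQ * Quv = κQ * (Z * Quv) := by ring
        _ ≤ 1 * (Z * Quv) := mul_le_mul_of_nonneg_right hb2 hZQ
        _ = Z * Quv := one_mul _
        _ ≤ Q' := hF3
  · rw [hQ]; exact mul_le_mul_of_nonneg_right hρ4 hQ'0.le
  · rw [hQ]; exact mul_le_mul_of_nonneg_right hρτψ hQ'0.le

/-- **The λ-free part of the kit's `Y` is `2Y`**: `ι₂/(2Q′) + ι₃/(4Q′²) + A′Q′/4 = 2·Y`. -/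
theorem towerLevNumericsG_Y₀_eq
    (hZ : 0 < Z) (hQuv : 0 ≤ Quv) (hq₀ : 0 ≤ q₀) (hQ' : Q' = Z * Quv + q₀ + 1)
    (hY : Y = ι₂ / (2 * Q') + W * Z ^ 3 * X / (4 * Q' ^ 2) + a * Q' / 2)
    (hA' : A' = a + 2 * Y / Q') (hι₃ : ι₃ = W * Z ^ 3 * X + A' * Q' ^ 3) :
    ι₂ / (2 * Q') + ι₃ / (4 * Q' ^ 2) + A' * Q' / 4 = 2 * Y := by
  have hQ'0 : 0 < Q' := lt_of_lt_of_le one_pos (towerLevNumericsG_one_le_Q' hZ hQuv hq₀ hQ')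
  have h1 : ι₃ / (4 * Q' ^ 2) = W * Z ^ 3 * X / (4 * Q' ^ 2) + A' * Q' / 4 := by
    rw [hι₃]; field_simp
  have h2 : A' * Q' / 2 = a * Q' / 2 + Y := by
    rw [hA']; field_simp
  calc ι₂ / (2 * Q') + ι₃ / (4 * Q' ^ 2) + A' * Q' / 4
      = ι₂ / (2 * Q') + W * Z ^ 3 * X / (4 * Q' ^ 2) + A' * Q' / 2 := by rw [h1]; ring
    _ = (ι₂ / (2 * Q') + W * Z ^ 3 * X / (4 * Q' ^ 2) + a * Q' / 2) + Y := by rw [h2]; ring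
    _ = 2 * Y := by rw [← hY]; ring

/-- **The amplitude rows `(N1) (N2)`** from `8·Φ·τ·Y ≤ 1` and `128·e·ψ³·τ⁴·Φ·κ_A·Y ≤ (1−r)·ρ³`. -/
theorem towerLevNumericsG_N1N2
    (hW : 0 < W) (hZ : 0 < Z) (hκA : 0 < κA) (hr1 : r < 1) (hQuv : 0 ≤ Quv) (ha₁ : 0 < a₁) (ha₂ : 0 ≤ a₂) (hq₀ : 0 ≤ q₀)
    (hι₂ : 0 ≤ ι₂) (hX : 0 ≤ X)
    (hρ : ρ = max 4 (2 * τ * ψ)) (hQ' : Q' = Z * Quv + q₀ + 1) (hQ : Q = ρ * Q') (ha : a = a₁ + κA * a₂)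
    (hY : Y = ι₂ / (2 * Q') + W * Z ^ 3 * X / (4 * Q' ^ 2) + a * Q' / 2) (hA : A = 2 * Y * (1 - r) / (κA * Q'))
    (hA' : A' = a + 2 * Y / Q') (hι₃ : ι₃ = W * Z ^ 3 * X + A' * Q' ^ 3)
    (amp1 : 8 * Φ * τ * Y ≤ 1) (amp2 : 128 * exp 1 * ψ ^ 3 * τ ^ 4 * Φ * κA * Y ≤ (1 - r) * ρ ^ 3) :
    Φ * (τ * (ι₂ / (2 * Q') + ι₃ / (4 * Q' ^ 2) + A' * Q' / 4)) ≤ 1 / 4 ∧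
      16 * exp 1 * ψ * (2 * τ * ψ * Q') ^ 2 * Φ * τ ^ 2 * (ι₂ / (2 * Q') + ι₃ / (4 * Q' ^ 2) + A' * Q' / 4) ^ 2 ≤ A * Q ^ 3 := by
  obtain ⟨_, hY0, hQ'0, _, _, _, _, _⟩ := towerLevNumericsG_pos hW hZ hκA hr1 hQuv ha₁ ha₂ hq₀ hι₂ hX hρ hQ' hQ ha hY hA hA' hι₃
  have hY₀ := towerLevNumericsG_Y₀_eq (ι₂ := ι₂) (W := W) (X := X) (a := a) hZ hQuv hq₀ hQ' hY hA' hι₃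
  rw [hY₀]
  constructor
  · nlinarith [amp1]
  · have hAQ3 : A * Q ^ 3 = (2 * Y * Q' ^ 2) * ((1 - r) * ρ ^ 3 / κA) := by
      rw [hA, hQ]; field_simp
    have hlhs : 16 * exp 1 * ψ * (2 * τ * ψ * Q') ^ 2 * Φ * τ ^ 2 * (2 * Y) ^ 2 =
        (2 * Y * Q' ^ 2) * (128 * exp 1 * ψ ^ 3 * τ ^ 4 * Φ * Y) := by ring
    rw [hAQ3, hlhs]
    refine mul_le_mul_of_nonneg_left ?_ (by positivity)
    rw [le_div_iff₀ hκA]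
    calc 128 * exp 1 * ψ ^ 3 * τ ^ 4 * Φ * Y * κA = 128 * exp 1 * ψ ^ 3 * τ ^ 4 * Φ * κA * Y := by ring
      _ ≤ (1 - r) * ρ ^ 3 := amp2

/-- **THE (I5)-LEV-G ROWS**: positivity; the seven floors; `hu₁ hu₂`; `(N1) (N2)`. -/
theorem towerLevNumericsG_rows
    (hW : 0 < W) (hZ : 0 < Z) (hκA : 0 < κA) (hκQ : 0 ≤ κQ) (hr1 : r < 1) (hQuv : 0 ≤ Quv) (ha₁ : 0 < a₁) (ha₂ : 0 ≤ a₂) (hq₀ : 0 ≤ q₀)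
    (hι₂ : 0 ≤ ι₂) (hX : 0 ≤ X)
    (hρ : ρ = max 4 (2 * τ * ψ)) (hQ' : Q' = Z * Quv + q₀ + 1) (hQ : Q = ρ * Q') (ha : a = a₁ + κA * a₂)
    (hY : Y = ι₂ / (2 * Q') + W * Z ^ 3 * X / (4 * Q' ^ 2) + a * Q' / 2) (hA : A = 2 * Y * (1 - r) / (κA * Q'))
    (hA' : A' = a + 2 * Y / Q') (hι₃ : ι₃ = W * Z ^ 3 * X + A' * Q' ^ 3)
    (hblock : max 1 Z * κQ * max 4 (2 * τ * ψ) ≤ 1)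
    (amp1 : 8 * Φ * τ * Y ≤ 1) (amp2 : 128 * exp 1 * ψ ^ 3 * τ ^ 4 * Φ * κA * Y ≤ (1 - r) * ρ ^ 3) :
    (0 < Q' ∧ 0 < Q ∧ 0 < A ∧ 0 ≤ A' ∧ 0 ≤ ι₃ ∧ 0 < A * Q ^ 3) ∧
    (a₁ ≤ A' ∧ κA * (a₂ + A / (1 - r)) ≤ A' ∧ Z * Quv ≤ Q' ∧ Z * κQ * max Q Quv ≤ Q' ∧ q₀ ≤ Q' ∧ W * Z ^ 3 * X ≤ ι₃ ∧ A' * Q' ^ 3 ≤ ι₃) ∧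
    (4 * Q' ≤ Q ∧ 2 * τ * ψ * Q' ≤ Q) ∧
    (Φ * (τ * (ι₂ / (2 * Q') + ι₃ / (4 * Q' ^ 2) + A' * Q' / 4)) ≤ 1 / 4 ∧
      16 * exp 1 * ψ * (2 * τ * ψ * Q') ^ 2 * Φ * τ ^ 2 * (ι₂ / (2 * Q') + ι₃ / (4 * Q' ^ 2) + A' * Q' / 4) ^ 2 ≤ A * Q ^ 3) := by
  obtain ⟨_, _, hQ'0, hQ0, hA0, hA'0, hι₃0, hAQ⟩ := towerLevNumericsG_pos hW hZ hκA hr1 hQuv ha₁ ha₂ hq₀ hι₂ hX hρ hQ' hQ ha hY hA hA' hι₃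
  obtain ⟨hF1, hF2⟩ := towerLevNumericsG_floorsA hW hZ hκA hr1 hQuv ha₁ ha₂ hq₀ hι₂ hX hρ hQ' hQ ha hY hA hA' hι₃
  obtain ⟨hF3, hFq, hF4, hu₁, hu₂⟩ := towerLevNumericsG_floorsQ hZ hκQ hQuv hq₀ hρ hQ' hQ hblock
  obtain ⟨N1, N2⟩ := towerLevNumericsG_N1N2 hW hZ hκA hr1 hQuv ha₁ ha₂ hq₀ hι₂ hX hρ hQ' hQ ha hY hA hA' hι₃ amp1 amp2
  have hF6 : W * Z ^ 3 * X ≤ ι₃ := by rw [hι₃]; linarith [show (0 : ℝ) ≤ A' * Q' ^ 3 by positivity]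
  have hF7 : A' * Q' ^ 3 ≤ ι₃ := by rw [hι₃]; linarith [show (0 : ℝ) ≤ W * Z ^ 3 * X by positivity]
  exact ⟨⟨hQ'0, hQ0, hA0, hA'0, hι₃0, hAQ⟩, ⟨hF1, hF2, hF3, hF4, hFq, hF6, hF7⟩, ⟨hu₁, hu₂⟩, N1, N2⟩

end Rows

/-! ## §2 All numerical hypotheses of the levelled law: from `λ ≤ λ₀`, and from the two doors -/

section All

variable {σ Φ ψ τ W Z κA κQ r Quv a₁ a₂ q₀ ι₁ ι₂ X ρ Q' Q a Y A A' ι₃ lam : ℝ}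

/-- **(I5)-LEV-G FROM `λ ≤ λ₀`**: the kit's six λ-dependent side conditions `hx₁ hx₂ hx₃ hy hθ hclose`, token-for-token. -/
theorem towerLevNumericsG_side_of_lam_le
    (hσ : 0 ≤ σ) (hΦ : 0 ≤ Φ) (hψ : 0 ≤ ψ) (hτ : 0 < τ)
    (hW : 0 < W) (hZ : 0 < Z) (hκA : 0 < κA) (hκQ : 0 ≤ κQ) (hr1 : r < 1) (hQuv : 0 ≤ Quv) (ha₁ : 0 < a₁) (ha₂ : 0 ≤ a₂) (hq₀ : 0 ≤ q₀)
    (hι₁ : 0 ≤ ι₁) (hι₂ : 0 ≤ ι₂) (hX : 0 ≤ X)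
    (hρ : ρ = max 4 (2 * τ * ψ)) (hQ' : Q' = Z * Quv + q₀ + 1) (hQ : Q = ρ * Q') (ha : a = a₁ + κA * a₂)
    (hY : Y = ι₂ / (2 * Q') + W * Z ^ 3 * X / (4 * Q' ^ 2) + a * Q' / 2) (hA : A = 2 * Y * (1 - r) / (κA * Q'))
    (hA' : A' = a + 2 * Y / Q') (hι₃ : ι₃ = W * Z ^ 3 * X + A' * Q' ^ 3)
    (hblock : max 1 Z * κQ * max 4 (2 * τ * ψ) ≤ 1)
    (amp1 : 8 * Φ * τ * Y ≤ 1) (amp2 : 128 * exp 1 * ψ ^ 3 * τ ^ 4 * Φ * κA * Y ≤ (1 - r) * ρ ^ 3)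
    (hlam : 0 ≤ lam)
    (hle : lam ≤ min 1 (min (1 / (8 * σ * Q' + 1)) (min (1 / (2 * exp 1 * τ * Q' + 1)) (min (1 / (4 * Φ * τ * ι₁ + 1))
      (min (1 / (2 * (Φ * (exp 1 * τ * ι₁ + (exp 1 * τ) ^ 2 * ι₂ + (exp 1 * τ) ^ 3 * ι₃ + A' * (exp 1 * τ * Q') ^ 2 / 2)) + 1))
        (min (A * Q ^ 3 / (16 * σ * Q' * A' * (4 * Q') ^ 3 + A * Q ^ 3))
          (A * Q ^ 3 / (16 * exp 1 * ψ * (2 * τ * ψ * Q') ^ 2 * Φ * τ ^ 2 * ι₁ ^ 2 + A * Q ^ 3)))))))) :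
    4 * σ * lam * Q' < 1 ∧ 2 * lam * τ * Q' ≤ 1 ∧ exp 1 * τ * lam * Q' < 1 ∧
      Φ * (τ * (ι₁ * lam + ι₂ / (2 * Q') + ι₃ / (4 * Q' ^ 2) + A' * Q' / 4)) < 1 ∧
      Φ * (exp 1 * τ * (ι₁ * lam) + (exp 1 * τ) ^ 2 * (ι₂ * lam) + (exp 1 * τ) ^ 3 * (ι₃ * lam ^ 2) +
        A' * (exp 1 * τ * Q') * ((exp 1 * τ * lam * Q') ^ 3 / (1 - exp 1 * τ * lam * Q'))) < 1 ∧
      A' * (4 * Q') ^ 3 * (4 * σ * lam * Q' / (1 - 4 * σ * lam * Q')) +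
        exp 1 * ψ * (2 * τ * ψ * Q') ^ 2 * (τ * (ι₁ * lam + ι₂ / (2 * Q') + ι₃ / (4 * Q' ^ 2) + A' * Q' / 4)) *
          (Φ * (τ * (ι₁ * lam + ι₂ / (2 * Q') + ι₃ / (4 * Q' ^ 2) + A' * Q' / 4)) /
            (1 - Φ * (τ * (ι₁ * lam + ι₂ / (2 * Q') + ι₃ / (4 * Q' ^ 2) + A' * Q' / 4)))) ≤ A * Q ^ 3 := by
  obtain ⟨⟨hQ'0, _, _, hA'0, hι₃0, hAQ⟩, _, _, N1, N2⟩ :=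
    towerLevNumericsG_rows hW hZ hκA hκQ hr1 hQuv ha₁ ha₂ hq₀ hι₂ hX hρ hQ' hQ ha hY hA hA' hι₃ hblock amp1 amp2
  exact towerNumerics_side_of_lam_le hσ hΦ hψ hτ.le hA'0 hQ'0.le hι₁ hι₂ hι₃0 hAQ hlam hle N1 N2

/-- **(I5)-LEV-G FROM THE TWO DOORS** (KL regime, `λ := B′·epsCoupling P U j`, any `B′ ≥ 0`). -/
theorem towerLevNumericsG_side_of_doors {P : SplitConsts} {U cc B' : ℝ} {n j : ℕ}
    (hK : 0 ≤ P.Klam) (hσ : 0 ≤ σ) (hΦ : 0 ≤ Φ) (hψ : 0 ≤ ψ) (hτ : 0 < τ)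
    (hW : 0 < W) (hZ : 0 < Z) (hκA : 0 < κA) (hκQ : 0 ≤ κQ) (hr1 : r < 1) (hQuv : 0 ≤ Quv) (ha₁ : 0 < a₁) (ha₂ : 0 ≤ a₂) (hq₀ : 0 ≤ q₀)
    (hι₁ : 0 ≤ ι₁) (hι₂ : 0 ≤ ι₂) (hX : 0 ≤ X) (hB' : 0 ≤ B') (hU : 0 ≤ U)
    (hreg : IsKLRegime U cc (-(n : ℤ))) (hj : j ≤ n)
    (hρ : ρ = max 4 (2 * τ * ψ)) (hQ' : Q' = Z * Quv + q₀ + 1) (hQ : Q = ρ * Q') (ha : a = a₁ + κA * a₂)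
    (hY : Y = ι₂ / (2 * Q') + W * Z ^ 3 * X / (4 * Q' ^ 2) + a * Q' / 2) (hA : A = 2 * Y * (1 - r) / (κA * Q'))
    (hA' : A' = a + 2 * Y / Q') (hι₃ : ι₃ = W * Z ^ 3 * X + A' * Q' ^ 3)
    (hblock : max 1 Z * κQ * max 4 (2 * τ * ψ) ≤ 1)
    (amp1 : 8 * Φ * τ * Y ≤ 1) (amp2 : 128 * exp 1 * ψ ^ 3 * τ ^ 4 * Φ * κA * Y ≤ (1 - r) * ρ ^ 3)
    (hUdoor : U ≤ min 1 (min (1 / (8 * σ * Q' + 1)) (min (1 / (2 * exp 1 * τ * Q' + 1)) (min (1 / (4 * Φ * τ * ι₁ + 1))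
      (min (1 / (2 * (Φ * (exp 1 * τ * ι₁ + (exp 1 * τ) ^ 2 * ι₂ + (exp 1 * τ) ^ 3 * ι₃ + A' * (exp 1 * τ * Q') ^ 2 / 2)) + 1))
        (min (A * Q ^ 3 / (16 * σ * Q' * A' * (4 * Q') ^ 3 + A * Q ^ 3))
          (A * Q ^ 3 / (16 * exp 1 * ψ * (2 * τ * ψ * Q') ^ 2 * Φ * τ ^ 2 * ι₁ ^ 2 + A * Q ^ 3))))))) / (2 * B' * P.Klam + 1))
    (hcdoor : cc ≤ min 1 (min (1 / (8 * σ * Q' + 1)) (min (1 / (2 * exp 1 * τ * Q' + 1)) (min (1 / (4 * Φ * τ * ι₁ + 1))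
      (min (1 / (2 * (Φ * (exp 1 * τ * ι₁ + (exp 1 * τ) ^ 2 * ι₂ + (exp 1 * τ) ^ 3 * ι₃ + A' * (exp 1 * τ * Q') ^ 2 / 2)) + 1))
        (min (A * Q ^ 3 / (16 * σ * Q' * A' * (4 * Q') ^ 3 + A * Q ^ 3))
          (A * Q ^ 3 / (16 * exp 1 * ψ * (2 * τ * ψ * Q') ^ 2 * Φ * τ ^ 2 * ι₁ ^ 2 + A * Q ^ 3))))))) * Real.log 4 / (2 * B' * P.Klam + 1)) :
    4 * σ * (B' * epsCoupling P U j) * Q' < 1 ∧ 2 * (B' * epsCoupling P U j) * τ * Q' ≤ 1 ∧ exp 1 * τ * (B' * epsCoupling P U j) * Q' < 1 ∧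
      Φ * (τ * (ι₁ * (B' * epsCoupling P U j) + ι₂ / (2 * Q') + ι₃ / (4 * Q' ^ 2) + A' * Q' / 4)) < 1 ∧
      Φ * (exp 1 * τ * (ι₁ * (B' * epsCoupling P U j)) + (exp 1 * τ) ^ 2 * (ι₂ * (B' * epsCoupling P U j)) +
        (exp 1 * τ) ^ 3 * (ι₃ * (B' * epsCoupling P U j) ^ 2) +
        A' * (exp 1 * τ * Q') * ((exp 1 * τ * (B' * epsCoupling P U j) * Q') ^ 3 / (1 - exp 1 * τ * (B' * epsCoupling P U j) * Q'))) < 1 ∧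
      A' * (4 * Q') ^ 3 * (4 * σ * (B' * epsCoupling P U j) * Q' / (1 - 4 * σ * (B' * epsCoupling P U j) * Q')) +
        exp 1 * ψ * (2 * τ * ψ * Q') ^ 2 * (τ * (ι₁ * (B' * epsCoupling P U j) + ι₂ / (2 * Q') + ι₃ / (4 * Q' ^ 2) + A' * Q' / 4)) *
          (Φ * (τ * (ι₁ * (B' * epsCoupling P U j) + ι₂ / (2 * Q') + ι₃ / (4 * Q' ^ 2) + A' * Q' / 4)) /
            (1 - Φ * (τ * (ι₁ * (B' * epsCoupling P U j) + ι₂ / (2 * Q') + ι₃ / (4 * Q' ^ 2) + A' * Q' / 4)))) ≤ A * Q ^ 3 := by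
  obtain ⟨⟨hQ'0, _, _, hA'0, hι₃0, hAQ⟩, _, _, N1, N2⟩ :=
    towerLevNumericsG_rows hW hZ hκA hκQ hr1 hQuv ha₁ ha₂ hq₀ hι₂ hX hρ hQ' hQ ha hY hA hA' hι₃ hblock amp1 amp2
  exact towerNumerics_side_of_doors hK hσ hΦ hψ hτ.le hA'0 hQ'0.le hι₁ hι₂ hι₃0 hAQ hB' hU hreg hj N1 N2 hUdoor hcdoor

end All

/-! ## §3 The choice of `B` -/

section Amp

variable {Φ ψ τ W Z κA r B ι₂ X ῑ₂ Xb a₁ a₂ â₁ â₂ a ab Q' Y Yb ρ : ℝ}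

/-- **`Y ≤ Ȳ/B`**: with `a₁ = â₁/B²`, `a₂ = â₂/B²`, `ι₂ = ῑ₂/B`, `X = X̄/B²`, `B ≥ 1`, and `Ȳ := ῑ₂/(2Q′) + W·Z³·X̄/(4Q′²) + (â₁ + κ_A·â₂)·Q′/2`. -/
theorem towerLevNumericsG_Y_le_of_B (hW : 0 < W) (hZ : 0 < Z) (hκA : 0 ≤ κA) (hB : 1 ≤ B) (hXb : 0 ≤ Xb) (hâ₁ : 0 ≤ â₁) (hâ₂ : 0 ≤ â₂) (hQ' : 0 < Q')
    (hι₂ : ι₂ = ῑ₂ / B) (hX : X = Xb / B ^ 2) (ha₁ : a₁ = â₁ / B ^ 2) (ha₂ : a₂ = â₂ / B ^ 2) (ha : a = a₁ + κA * a₂) (hab : ab = â₁ + κA * â₂)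
    (hY : Y = ι₂ / (2 * Q') + W * Z ^ 3 * X / (4 * Q' ^ 2) + a * Q' / 2)
    (hYb : Yb = ῑ₂ / (2 * Q') + W * Z ^ 3 * Xb / (4 * Q' ^ 2) + ab * Q' / 2) :
    Y ≤ Yb / B := by
  have hB0 : 0 < B := lt_of_lt_of_le one_pos hB
  have hBB : B ≤ B ^ 2 := by nlinarith
  have hinv : 1 / B ^ 2 ≤ 1 / B := one_div_le_one_div_of_le hB0 hBB
  have hab0 : 0 ≤ ab := by rw [hab]; positivity
  have haB : a = ab / B ^ 2 := by rw [ha, ha₁, ha₂, hab]; ring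
  have h1 : ι₂ / (2 * Q') = (ῑ₂ / (2 * Q')) / B := by rw [hι₂]; field_simp
  have h2 : W * Z ^ 3 * X / (4 * Q' ^ 2) ≤ (W * Z ^ 3 * Xb / (4 * Q' ^ 2)) / B := by
    rw [hX]
    have hc : 0 ≤ W * Z ^ 3 * Xb / (4 * Q' ^ 2) := by positivity
    calc W * Z ^ 3 * (Xb / B ^ 2) / (4 * Q' ^ 2) = (W * Z ^ 3 * Xb / (4 * Q' ^ 2)) * (1 / B ^ 2) := by ring
      _ ≤ (W * Z ^ 3 * Xb / (4 * Q' ^ 2)) * (1 / B) := mul_le_mul_of_nonneg_left hinv hc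
      _ = (W * Z ^ 3 * Xb / (4 * Q' ^ 2)) / B := by ring
  have h3 : a * Q' / 2 ≤ (ab * Q' / 2) / B := by
    rw [haB]
    have hc : 0 ≤ ab * Q' / 2 := by positivity
    calc ab / B ^ 2 * Q' / 2 = (ab * Q' / 2) * (1 / B ^ 2) := by ring
      _ ≤ (ab * Q' / 2) * (1 / B) := mul_le_mul_of_nonneg_left hinv hc
      _ = (ab * Q' / 2) / B := by ring
  calc Y = ι₂ / (2 * Q') + W * Z ^ 3 * X / (4 * Q' ^ 2) + a * Q' / 2 := hY
    _ ≤ (ῑ₂ / (2 * Q')) / B + (W * Z ^ 3 * Xb / (4 * Q' ^ 2)) / B + (ab * Q' / 2) / B := by rw [h1]; linarith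
    _ = Yb / B := by rw [hYb]; ring

/-- **THE AMPLITUDE ROWS FROM `B ≥ B₀`**: with the scalings of `towerLevNumericsG_Y_le_of_B` and
`B ≥ max 1 (max (8·Φ·τ·Ȳ) (128·e·ψ³·τ⁴·Φ·κ_A·Ȳ / ((1−r)·ρ³)))` (`r < 1`, `ρ > 0`): `8·Φ·τ·Y ≤ 1` and `128·e·ψ³·τ⁴·Φ·κ_A·Y ≤ (1−r)·ρ³`. -/
theorem towerLevNumericsG_amp_of_le_B (hΦ : 0 ≤ Φ) (hψ : 0 ≤ ψ) (hτ : 0 < τ) (hW : 0 < W) (hZ : 0 < Z) (hκA : 0 ≤ κA) (hr1 : r < 1) (hρ : 0 < ρ)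
    (hῑ₂ : 0 ≤ ῑ₂) (hXb : 0 ≤ Xb) (hâ₁ : 0 ≤ â₁) (hâ₂ : 0 ≤ â₂) (hQ' : 0 < Q')
    (hι₂ : ι₂ = ῑ₂ / B) (hX : X = Xb / B ^ 2) (ha₁ : a₁ = â₁ / B ^ 2) (ha₂ : a₂ = â₂ / B ^ 2) (ha : a = a₁ + κA * a₂) (hab : ab = â₁ + κA * â₂)
    (hY : Y = ι₂ / (2 * Q') + W * Z ^ 3 * X / (4 * Q' ^ 2) + a * Q' / 2)
    (hYb : Yb = ῑ₂ / (2 * Q') + W * Z ^ 3 * Xb / (4 * Q' ^ 2) + ab * Q' / 2)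
    (hB : max 1 (max (8 * Φ * τ * Yb) (128 * exp 1 * ψ ^ 3 * τ ^ 4 * Φ * κA * Yb / ((1 - r) * ρ ^ 3))) ≤ B) :
    8 * Φ * τ * Y ≤ 1 ∧ 128 * exp 1 * ψ ^ 3 * τ ^ 4 * Φ * κA * Y ≤ (1 - r) * ρ ^ 3 := by
  have hB1 : 1 ≤ B := le_trans (le_max_left _ _) hB
  have hB0 : 0 < B := lt_of_lt_of_le one_pos hB1
  have hr : 0 < 1 - r := sub_pos.2 hr1
  have hrρ : 0 < (1 - r) * ρ ^ 3 := by positivity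
  have hab0 : 0 ≤ ab := by rw [hab]; positivity
  have hYb0 : 0 ≤ Yb := by rw [hYb]; positivity
  have hYle : Y ≤ Yb / B := towerLevNumericsG_Y_le_of_B hW hZ hκA hB1 hXb hâ₁ hâ₂ hQ' hι₂ hX ha₁ ha₂ ha hab hY hYb
  have hBa : 8 * Φ * τ * Yb ≤ B := le_trans (le_trans (le_max_left _ _) (le_max_right _ _)) hB
  have hBb : 128 * exp 1 * ψ ^ 3 * τ ^ 4 * Φ * κA * Yb / ((1 - r) * ρ ^ 3) ≤ B := le_trans (le_trans (le_max_right _ _) (le_max_right _ _)) hB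
  have hc1 : 0 ≤ 8 * Φ * τ := by positivity
  have hc2 : 0 ≤ 128 * exp 1 * ψ ^ 3 * τ ^ 4 * Φ * κA := by positivity
  constructor
  · calc 8 * Φ * τ * Y ≤ 8 * Φ * τ * (Yb / B) := mul_le_mul_of_nonneg_left hYle hc1
      _ = (8 * Φ * τ * Yb) / B := by ring
      _ ≤ 1 := by rw [div_le_one hB0]; exact hBa
  · calc 128 * exp 1 * ψ ^ 3 * τ ^ 4 * Φ * κA * Y ≤ 128 * exp 1 * ψ ^ 3 * τ ^ 4 * Φ * κA * (Yb / B) := mul_le_mul_of_nonneg_left hYle hc2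
      _ = (128 * exp 1 * ψ ^ 3 * τ ^ 4 * Φ * κA * Yb) / B := by ring
      _ ≤ (1 - r) * ρ ^ 3 := by
          rw [div_le_iff₀ hB0]
          have := (div_le_iff₀ hrρ).1 hBb
          nlinarith

/-- **A blocking scale exists** in the generic form: for `κ_Q(d) := C·(2^{d−1})⁻¹` there is `d ≥ 2` with `max 1 Z · κ_Q(d) · max 4 (2τψ) ≤ 1` (cf.
`towerLevNumerics_exists_blocking`). -/
theorem towerLevNumericsG_exists_blocking (Z C τ ψ : ℝ) :
    ∃ d : ℕ, 2 ≤ d ∧ max 1 Z * (C * ((2 : ℝ) ^ (d - 1))⁻¹) * max 4 (2 * τ * ψ) ≤ 1 := by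
  obtain ⟨n, hn⟩ := pow_unbounded_of_one_lt (max 1 Z * C * max 4 (2 * τ * ψ)) (by norm_num : (1 : ℝ) < 2)
  refine ⟨n + 2, by omega, ?_⟩
  have h2 : (0 : ℝ) < (2 : ℝ) ^ (n + 2 - 1) := by positivity
  have hle : max 1 Z * C * max 4 (2 * τ * ψ) ≤ (2 : ℝ) ^ (n + 2 - 1) :=
    hn.le.trans (pow_le_pow_right₀ (by norm_num) (by omega))
  calc max 1 Z * (C * ((2 : ℝ) ^ (n + 2 - 1))⁻¹) * max 4 (2 * τ * ψ) = (max 1 Z * C * max 4 (2 * τ * ψ)) / (2 : ℝ) ^ (n + 2 - 1) := by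
        field_simp
    _ ≤ 1 := (div_le_one h2).2 hle

end Amp

end Summit.HubbardSuperconductivity.HubbardSuperconductivity.Theorems.EngineV8

end
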